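import Summits.CriticalPhenomena.PercolationContinuityZ3.Theorems.PercNearOneGluingNoHeavyLowerTailAntitheticPendant
import Summits.CriticalPhenomena.PercolationContinuityZ3.Theorems.PercNearOneGluingNoHeavyLowerTailAntitheticUCone
import Summits.CriticalPhenomena.PercolationContinuityZ3.Theorems.PercNearOneGluingNoHeavyLowerTailAntitheticApexCone
import HarnessLib

/-!
# `NoHeavyLowerTail` (stmt-CriticalPhenomena-4575) — antithetic cluster pairs: THEOREM U′ (CONJECTURE U′ of gen 37: a vertex `k₀ ≠ s`,
# `sk₀ ∈ E`, adjacent to every vertex of degree `≥ 2` ⇒ `BIC_E(R) ≥ 0` for EVERY `R`) and THEOREM I′ (the same for `s` itself, with sinks)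
# (prim-hp-2 gen 39; HOME/MEMO-gen39-pendant.md, MEMO-gen37 §4f)

Support file (`--supports stmt-CriticalPhenomena-4575`, hull-port prover `prim-hp-2`, gen 39).  No definitions, no named facts, no sorries;
standard axioms.

SETTING as in …AntitheticPendant (`T_E(R,X)`, `BIC_E(R) = T_E(R,∅)`; "good" = `T ≥ 0` for all increasing `F, G`).
* `Antithetic.Pendant.good_of_spokes` — if every vertex `v ≠ c` not adjacent to `c` meets only loops, goodness of `E` follows from goodness of
  `E ∪ {all pairs cv}` (pruning the spokes of the isolated vertices one by one, `Pendant.good_of_insert`).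
* `Antithetic.Pendant.good_of_leafClass` — the engine: if `BIC ≥ 0` on the class "`c` adjacent to every other vertex" (for `c = s` THEOREM I,
  for `c = k₀ ≠ s` with `sk₀ ∈ E` THEOREM U), then `BIC_E(R) ≥ 0` whenever `c` is adjacent to every vertex `≠ c` meeting two distinct non-loop
  pairs.  Induction on the number of vertices of positive degree not adjacent to `c`: such a vertex is a pendant vertex `≠ s`, its pair is
  removed by the PENDANT-EDGE LEMMA (`Pendant.good_insert`), and the class is kept; at the end `good_of_spokes`.
* `Antithetic.univLeaf_bic_nonneg` — THEOREM U′: `k₀ ≠ s`, `sk₀ ∈ E`, `k₀` adjacent to every vertex `≠ k₀` of degree `≥ 2` ⇒ `BIC_E(R) ≥ 0`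
  for every `R` (CONJECTURE U′, MEMO-gen37 §4f; rule census there: 0 failures on 19 226 instances, now superseded).
* `Antithetic.coneLeaf_bic_nonneg`, `Antithetic.coneLeaf_tsum_nonneg` — THEOREM I′: `s` adjacent to every vertex of degree `≥ 2` ⇒
  `BIC_E(R) ≥ 0` for every `R`, and (the class being closed under deleting the pairs at a vertex) `T_E(R,X) ≥ 0` for all `R ∌ s`, `X` by the
  peeling meta-theorem — cones with pendant vertices hanging anywhere, arbitrary sinks.
Deeper hanging forests: `Pendant.good_chain` (…AntitheticPendant) with any of the programme's classes as the base.
[cite: VandenbergHaggstromKahn2005, §1 p. 3 (open cluster `C_s`)]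
-/

noncomputable section

namespace Summit.CriticalPhenomena.PercolationContinuityZ3.Theorems

open Literature.Probability.Percolation
open scoped Classical symmDiff

namespace Antithetic

namespace Pendant

variable {V : Type*} [Fintype V]

/-- **Spoking the isolated vertices**: if every `v ≠ c` with `cv ∉ E` meets only loops of `E` (and `c = s` or `cs ∈ E`), then goodness of
`E ∪ {cv : v ≠ c}` for `(R, ∅)` implies goodness of `E`. [this work] -/
theorem good_of_spokes (s c : V) (E : Set (Sym2 V)) (hcs : c = s ∨ s(c, s) ∈ E)
    (hiso : ∀ v, v ≠ c → s(c, v) ∉ E → ∀ f ∈ E, v ∈ f → f.IsDiag) (R : Set V)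
    (hgood : ∀ F G : Set (Sym2 V) → ℝ, Monotone F → Monotone G →
      0 ≤ Peel.tsum F G (E ∪ {f | ∃ v, v ≠ c ∧ f = s(c, v)}) s R ∅) :
    ∀ F G : Set (Sym2 V) → ℝ, Monotone F → Monotone G → 0 ≤ Peel.tsum F G E s R ∅ := by
  -- prune the spokes of the vertices of a finite set `T` of isolated vertices, one at a time
  have key : ∀ T : Finset V, (∀ v ∈ T, v ≠ c ∧ s(c, v) ∉ E) →
      (∀ F G : Set (Sym2 V) → ℝ, Monotone F → Monotone G → 0 ≤ Peel.tsum F G (E ∪ {f | ∃ v ∈ T, f = s(c, v)}) s R ∅) →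
      ∀ F G : Set (Sym2 V) → ℝ, Monotone F → Monotone G → 0 ≤ Peel.tsum F G E s R ∅ := by
    intro T
    induction T using Finset.induction_on with
    | empty =>
      intro _ hg
      have : E ∪ {f | ∃ v ∈ (∅ : Finset V), f = s(c, v)} = E := by
        ext f; simp
      rwa [this] at hg
    | insert v T hvT ih =>
      intro hT hg
      have hv := hT v (Finset.mem_insert_self v T)
      have hT' : ∀ w ∈ T, w ≠ c ∧ s(c, w) ∉ E := fun w hw => hT w (Finset.mem_insert_of_mem hw)
      refine ih hT' fun F G hF hG => ?_
      have hE : E ∪ {f | ∃ w ∈ insert v T, f = s(c, w)} = insert s(c, v) (E ∪ {f | ∃ w ∈ T, f = s(c, w)}) := by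
        ext f
        simp only [Set.mem_union, Set.mem_setOf_eq, Finset.mem_insert, Set.mem_insert_iff]
        constructor
        · rintro (h | ⟨w, rfl | hw, rfl⟩)
          · exact Or.inr (Or.inl h)
          · exact Or.inl rfl
          · exact Or.inr (Or.inr ⟨w, hw, rfl⟩)
        · rintro (rfl | h | ⟨w, hw, rfl⟩)
          · exact Or.inr ⟨v, Or.inl rfl, rfl⟩
          · exact Or.inl h
          · exact Or.inr ⟨w, Or.inr hw, rfl⟩
      have hvs : s ≠ v := by
        rintro rfl
        rcases hcs with h | h
        · exact hv.1 h.symm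
        · exact hv.2 h
      have hℓ : ∀ f ∈ E ∪ {f | ∃ w ∈ T, f = s(c, w)}, v ∈ f → f.IsDiag := by
        rintro f (hf | ⟨w, hw, rfl⟩) hvf
        · exact hiso v hv.1 hv.2 f hf hvf
        · rcases Sym2.mem_iff.1 hvf with h | h
          · exact absurd h hv.1
          · exact absurd (h ▸ hw) hvT
      rw [hE] at hg
      exact good_of_insert hℓ hv.1.symm hvs R ∅ (Set.notMem_empty v) hg hF hG
  refine key (Finset.univ.filter fun v => v ≠ c ∧ s(c, v) ∉ E) (fun v hv => (Finset.mem_filter.1 hv).2) ?_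
  have hE : E ∪ {f | ∃ v ∈ Finset.univ.filter (fun v => v ≠ c ∧ s(c, v) ∉ E), f = s(c, v)} = E ∪ {f | ∃ v, v ≠ c ∧ f = s(c, v)} := by
    ext f
    simp only [Set.mem_union, Set.mem_setOf_eq, Finset.mem_filter, Finset.mem_univ, true_and]
    constructor
    · rintro (h | ⟨v, ⟨hvc, -⟩, rfl⟩)
      · exact Or.inl h
      · exact Or.inr ⟨v, hvc, rfl⟩
    · rintro (h | ⟨v, hvc, rfl⟩)
      · exact Or.inl h
      · by_cases hcv : s(c, v) ∈ E
        · exact Or.inl hcv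
        · exact Or.inr ⟨v, ⟨hvc, hcv⟩, rfl⟩
  rw [hE]
  exact hgood

/-- **The pendant-vertex engine.**  Suppose `BIC ≥ 0` (all `R ∌ s`, all increasing `F, G`) on every edge set in which `c` is adjacent to every
other vertex (and `c = s` or `cs` present).  Then `BIC_E(R) ≥ 0` whenever `c = s` or `cs ∈ E`, and `c` is adjacent to every vertex `v ≠ c`
meeting two distinct non-loop pairs of `E` (pendant and isolated vertices are exempt). [this work] -/
theorem good_of_leafClass (s c : V)
    (hbase : ∀ E' : Set (Sym2 V), (c = s ∨ s(c, s) ∈ E') → (∀ v, v ≠ c → s(c, v) ∈ E') →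
      ∀ R : Set V, s ∉ R → ∀ F G : Set (Sym2 V) → ℝ, Monotone F → Monotone G → 0 ≤ Peel.tsum F G E' s R ∅)
    (E : Set (Sym2 V)) (hcs : c = s ∨ s(c, s) ∈ E)
    (hcl : ∀ v a b, v ≠ c → a ≠ v → b ≠ v → a ≠ b → s(v, a) ∈ E → s(v, b) ∈ E → s(c, v) ∈ E)
    (R : Set V) (hR : s ∉ R) :
    ∀ F G : Set (Sym2 V) → ℝ, Monotone F → Monotone G → 0 ≤ Peel.tsum F G E s R ∅ := by
  -- no bad vertex (`≠ c`, not adjacent to `c`, meeting a non-loop pair): spoke the isolated vertices and use the base class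
  have key : ∀ E : Set (Sym2 V), (c = s ∨ s(c, s) ∈ E) →
      (¬ ∃ v, v ≠ c ∧ s(c, v) ∉ E ∧ ∃ a, a ≠ v ∧ s(v, a) ∈ E) →
      ∀ F G : Set (Sym2 V) → ℝ, Monotone F → Monotone G → 0 ≤ Peel.tsum F G E s R ∅ := by
    intro E hcs hno
    have hiso : ∀ v, v ≠ c → s(c, v) ∉ E → ∀ f ∈ E, v ∈ f → f.IsDiag := by
      intro v hvc hcv f hf hvf
      obtain ⟨a, rfl⟩ := Sym2.mem_iff_exists.1 hvf
      rw [Sym2.mk_isDiag_iff]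
      by_contra hva
      exact hno ⟨v, hvc, hcv, a, fun h => hva h.symm, hf⟩
    refine good_of_spokes s c E hcs hiso R (hbase _ (hcs.imp id fun h => Or.inl h) (fun v hvc => ?_) R hR)
    by_cases h : s(c, v) ∈ E
    · exact Or.inl h
    · exact Or.inr ⟨v, hvc, rfl⟩
  -- induction on the number of bad vertices
  set bad : Set (Sym2 V) → Finset V := fun E => Finset.univ.filter fun v => v ≠ c ∧ s(c, v) ∉ E ∧ ∃ a, a ≠ v ∧ s(v, a) ∈ E
    with hbad
  have hmem : ∀ (E : Set (Sym2 V)) (v : V), v ∈ bad E ↔ (v ≠ c ∧ s(c, v) ∉ E ∧ ∃ a, a ≠ v ∧ s(v, a) ∈ E) := fun E v => by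
    simp only [hbad, Finset.mem_filter, Finset.mem_univ, true_and]
  suffices H : ∀ (n : ℕ) (E : Set (Sym2 V)), (bad E).card ≤ n →
      (c = s ∨ s(c, s) ∈ E) → (∀ v a b, v ≠ c → a ≠ v → b ≠ v → a ≠ b → s(v, a) ∈ E → s(v, b) ∈ E → s(c, v) ∈ E) →
      ∀ F G : Set (Sym2 V) → ℝ, Monotone F → Monotone G → 0 ≤ Peel.tsum F G E s R ∅ from H _ E le_rfl hcs hcl
  intro n
  induction n with
  | zero =>
    intro E hcard hcs _
    refine key E hcs fun ⟨v, hv⟩ => ?_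
    have : 0 < (bad E).card := Finset.card_pos.2 ⟨v, (hmem E v).2 hv⟩
    omega
  | succ n ih =>
    intro E hcard hcs hcl
    by_cases hex : ∃ v, v ≠ c ∧ s(c, v) ∉ E ∧ ∃ a, a ≠ v ∧ s(v, a) ∈ E
    swap
    · exact key E hcs hex
    obtain ⟨v, hvc, hcv, a, hav, hva⟩ := hex
    -- `v` is a pendant vertex `≠ s` with unique neighbour `a`
    have hvs : v ≠ s := by
      rintro rfl
      rcases hcs with h | h
      · exact hvc h.symm
      · exact hcv h
    have huniq : ∀ b, b ≠ v → s(v, b) ∈ E → b = a := fun b hbv hvb => by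
      by_contra hba
      exact hcv (hcl v a b hvc hav hbv (fun h => hba h.symm) hva hvb)
    set E₀ : Set (Sym2 V) := E \ {s(a, v)} with hE₀
    have hE : insert s(a, v) E₀ = E := by
      rw [hE₀, Set.insert_sdiff_singleton, Set.insert_eq_of_mem]
      rw [Sym2.eq_swap]; exact hva
    have hiso : ∀ f ∈ E₀, v ∈ f → f.IsDiag := by
      rintro f ⟨hfE, hfne⟩ hvf
      obtain ⟨b, rfl⟩ := Sym2.mem_iff_exists.1 hvf
      rw [Sym2.mk_isDiag_iff]
      by_contra hvb
      refine hfne (Set.mem_singleton_iff.2 ?_)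
      rw [huniq b (fun h => hvb h.symm) hfE, Sym2.eq_swap]
    have hcs₀ : c = s ∨ s(c, s) ∈ E₀ := by
      refine hcs.imp id fun h => ⟨h, fun h' => ?_⟩
      rcases Sym2.eq_iff.1 (Set.mem_singleton_iff.1 h') with ⟨-, h2⟩ | ⟨h1, -⟩
      · exact hvs h2.symm
      · exact hvc h1.symm
    have hcl₀ : ∀ w a' b', w ≠ c → a' ≠ w → b' ≠ w → a' ≠ b' → s(w, a') ∈ E₀ → s(w, b') ∈ E₀ → s(c, w) ∈ E₀ := by
      intro w a' b' hwc ha'w hb'w ha'b' h1 h2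
      refine ⟨hcl w a' b' hwc ha'w hb'w ha'b' h1.1 h2.1, fun h => ?_⟩
      rcases Sym2.eq_iff.1 (Set.mem_singleton_iff.1 h) with ⟨-, hwv⟩ | ⟨hcv', -⟩
      · subst hwv
        exact ha'b' ((huniq a' ha'w h1.1).trans (huniq b' hb'w h2.1).symm)
      · exact hvc hcv'.symm
    -- the bad set shrinks
    have hnot₀ : ∀ a', a' ≠ v → s(v, a') ∉ E₀ := fun a' ha' h =>
      h.2 (Set.mem_singleton_iff.2 (by rw [huniq a' ha' h.1, Sym2.eq_swap]))
    have hsub : bad E₀ ⊆ bad E := by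
      intro w hw
      rw [hmem] at hw ⊢
      obtain ⟨hwc, hcw, a', ha'w, hwa'⟩ := hw
      have hwv : w ≠ v := by
        rintro rfl
        exact hnot₀ a' ha'w hwa'
      refine ⟨hwc, fun h => hcw ⟨h, fun h' => ?_⟩, a', ha'w, hwa'.1⟩
      rcases Sym2.eq_iff.1 (Set.mem_singleton_iff.1 h') with ⟨-, h2⟩ | ⟨h1, -⟩
      · exact hwv h2
      · exact hvc h1.symm
    have hvin : v ∈ bad E := (hmem E v).2 ⟨hvc, hcv, a, hav, hva⟩
    have hvnot : v ∉ bad E₀ := fun h => by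
      obtain ⟨-, -, a', ha', h'⟩ := (hmem E₀ v).1 h
      exact hnot₀ a' ha' h'
    have hlt := Finset.card_lt_card (Finset.ssubset_iff_subset_ne.2 ⟨hsub, fun h => hvnot (h ▸ hvin)⟩)
    have hgood₀ := ih E₀ (by omega) hcs₀ hcl₀
    rw [← hE]
    exact fun F G hF hG => good_insert hiso hav hvs.symm R ∅ (Set.notMem_empty v) hgood₀ hF hG

end Pendant

section Theorems

variable {V : Type*} [Fintype V]

/-- **THEOREM U′ (prim-hp-2 gen 39; CONJECTURE U′ of MEMO-gen37 §4f): BIC with a vertex adjacent to all vertices of degree ≥ 2.**  `E` an edge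
set on a finite vertex type, `s` a source, `k₀ ≠ s` with `sk₀ ∈ E` and `k₀` adjacent to every vertex `v ≠ k₀` meeting two distinct non-loop
pairs (pendant and isolated vertices may fail to be adjacent to `k₀`).  Then for every `R` and all increasing `F, G`,
`0 ≤ Σ_{ω : no r ∈ R is joined to s both in ω ∩ E and in ωᶜ ∩ E} (F(C_s(ω∩E)) − F(C_s(ωᶜ∩E)))·(G(C_s(ω∩E)) − G(C_s(ωᶜ∩E)))`. [this work] -/
theorem univLeaf_bic_nonneg (E : Set (Sym2 V)) (s k₀ : V) (hk : k₀ ≠ s) (hsk : s(k₀, s) ∈ E)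
    (hleaf : ∀ v a b, v ≠ k₀ → a ≠ v → b ≠ v → a ≠ b → s(v, a) ∈ E → s(v, b) ∈ E → s(k₀, v) ∈ E)
    (R : Set V) {F G : Set (Sym2 V) → ℝ} (hF : Monotone F) (hG : Monotone G) :
    0 ≤ ∑ ω ∈ Finset.univ.filter (fun ω : Set (Sym2 V) =>
        ∀ r ∈ R, ¬ ((openGraph (ω ∩ E)).Reachable s r ∧ (openGraph (ωᶜ ∩ E)).Reachable s r)),
      (F (openEdgeCluster (ω ∩ E) s) - F (openEdgeCluster (ωᶜ ∩ E) s)) *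
        (G (openEdgeCluster (ω ∩ E) s) - G (openEdgeCluster (ωᶜ ∩ E) s)) := by
  rw [← Pendant.tsum_empty_eq]
  by_cases hR : s ∈ R
  · rw [Peel.tsum_eq_zero_of_mem_R F G E s ∅ hR]
  refine Pendant.good_of_leafClass s k₀ ?_ E (Or.inr hsk) hleaf R hR F G hF hG
  intro E' _ huniv R' _ F' G' hF' hG'
  rw [Pendant.tsum_empty_eq]
  exact univCone_bic_nonneg E' s k₀ hk huniv R' hF' hG'

/-- **THEOREM I′ (prim-hp-2 gen 39): BIC on cones with pendant vertices anywhere.**  `s` adjacent to every vertex `v ≠ s` meeting two distinct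
non-loop pairs.  Then `BIC_E(R) ≥ 0` for every `R` (statement as in `univLeaf_bic_nonneg`). [this work] -/
theorem coneLeaf_bic_nonneg (E : Set (Sym2 V)) (s : V)
    (hleaf : ∀ v a b, v ≠ s → a ≠ v → b ≠ v → a ≠ b → s(v, a) ∈ E → s(v, b) ∈ E → s(s, v) ∈ E)
    (R : Set V) {F G : Set (Sym2 V) → ℝ} (hF : Monotone F) (hG : Monotone G) :
    0 ≤ ∑ ω ∈ Finset.univ.filter (fun ω : Set (Sym2 V) =>
        ∀ r ∈ R, ¬ ((openGraph (ω ∩ E)).Reachable s r ∧ (openGraph (ωᶜ ∩ E)).Reachable s r)),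
      (F (openEdgeCluster (ω ∩ E) s) - F (openEdgeCluster (ωᶜ ∩ E) s)) *
        (G (openEdgeCluster (ω ∩ E) s) - G (openEdgeCluster (ωᶜ ∩ E) s)) := by
  rw [← Pendant.tsum_empty_eq]
  by_cases hR : s ∈ R
  · rw [Peel.tsum_eq_zero_of_mem_R F G E s ∅ hR]
  refine Pendant.good_of_leafClass s s ?_ E (Or.inl rfl) hleaf R hR F G hF hG
  intro E' _ hcone R' hR' F' G' hF' hG'
  rw [Pendant.tsum_empty_eq]
  exact cone_bic_nonneg E' s hcone R' hR' hF' hG'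

/-- **THEOREM I′ with sinks**: `s` adjacent to every vertex of degree `≥ 2` ⇒ `T_E(R,X) ≥ 0` for all `R ∌ s` and all sink sets `X` (the class is
closed under deleting the pairs at a vertex, so the peeling meta-theorem applies); in particular the antithetic BHK inequality with sinks
`SC(E,X) ≥ 0` on cones with pendant vertices. [this work] -/
theorem coneLeaf_tsum_nonneg (F G : Set (Sym2 V) → ℝ) (hF : Monotone F) (hG : Monotone G) (E : Set (Sym2 V)) (s : V)
    (hleaf : ∀ v a b, v ≠ s → a ≠ v → b ≠ v → a ≠ b → s(v, a) ∈ E → s(v, b) ∈ E → s(s, v) ∈ E)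
    (R X : Set V) (hRs : s ∉ R) : 0 ≤ Peel.tsum F G E s R X := by
  let P : Set (Sym2 V) → Prop := fun E' => ∀ v a b, v ≠ s → a ≠ v → b ≠ v → a ≠ b → s(v, a) ∈ E' → s(v, b) ∈ E' → s(s, v) ∈ E'
  have hPeel : ∀ E', P E' → ∀ y, y ≠ s → P (E' \ {e | y ∈ e}) := by
    intro E' hE' y hys v a b hvs hav hbv hab h1 h2
    refine ⟨hE' v a b hvs hav hbv hab h1.1 h2.1, fun hy => ?_⟩
    rcases Sym2.mem_iff.1 hy with rfl | rfl
    · exact hys rfl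
    · exact h1.2 (Sym2.mem_mk_left _ _)
  refine Peel.tsum_nonneg_of_bic_family F G s P hPeel ?_ E hleaf R X hRs
  intro E' hE' R' _
  rw [Pendant.tsum_empty_eq]
  exact coneLeaf_bic_nonneg E' s hE' R' hF hG

end Theorems

end Antithetic

end Summit.CriticalPhenomena.PercolationContinuityZ3.Theorems
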